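import Summits.Parity.BatemanHorn.Theorems.AlmostPrimeZerosSystemLSDRealSegmentSandwich
import Summits.Parity.BatemanHorn.Theorems.AlmostPrimeZerosSystemLSDRealSegmentLocalMult
import HarnessLib

/-!
# Route `AlmostPrimeZeros`, crux `SystemLSDRealSegment` (stmt-Parity-11292), line
# `beta-thinned-root-kernel`: the `S`-smooth Type-I sandwich (`smoothTypeI_sandwich`)

For a Bateman–Horn system `f = (f₁,…,f_k)`, real `y ≥ 1`, a level `x` and a smoothness bound `S`, the
Type-I sum restricted to divisor tuples whose product `m = ∏ dᵢ` is `S`-smooth,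
`T_x^{(S)}(y) = Σ_{0 ≤ n ≤ x} Σ_{d ∈ tuples f n, ∏ dᵢ ≤ x, ∏ dᵢ ∈ smoothNumbers S} ∏ᵢ h_y(dᵢ)`,
satisfies, with a constant `C` depending on `f` and `y` only (NOT on `x` or `S`),
`|T_x^{(S)}(y) − (x+1) Σ_{1 ≤ m ≤ x, m S-smooth} b(m)| ≤ C (1 + Σ_{1 ≤ m ≤ x} m·b(m))`,
`b(m) = bCoeff f y m`.

Proof: verbatim the proof of the unrestricted sandwich `stub_typeISandwich`
(`Summits/Parity/BatemanHorn/Theorems/AlmostPrimeZerosSystemLSDRealSegmentSandwich.lean`) with one extra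
filter.  The smoothness condition is a condition on `m = ∏ dᵢ` only, so after Fubini over the divisor
tuples (`sum_filter_tuples_smooth_eq`, `sum_Ico_sum_filter_tuples_smooth_eq`) it becomes the filter
`m ∈ smoothNumbers S` on the outer `m`-sum; the complete-residue-system count
`abs_card_filter_Ico_sub_tupleDens_le` is applied tuple by tuple on the rows `n ≥ n₀` (all values `≥ 1`
there, `exists_forall_one_le_eval`), giving the error `(1 + n₀) Σ_{m smooth} m·b(m) ≤ (1 + n₀) Σ_m m·b(m)`
(all terms `≥ 0` for `y ≥ 1`, `bCoeff_nonneg`); the rows `n < n₀` contribute between `0` and the constant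
`Σ_{n<n₀} Σ_{d ∈ tuples f n} ∏ h_y(dᵢ)` (weights `≥ 0`, `prod_thinWeight_nonneg`).

References: H. Halberstam, H.-E. Richert, *Sieve Methods* (1974), Lemma 5.4 and §5.3 (complete residue
systems); the line card `Cruxes/SystemLSDRealSegment/Lines/beta-thinned-root-kernel.md`.
-/

open Filter Finset Polynomial
open scoped BigOperators Topology

namespace Summit.Parity.BatemanHorn.Cruxes.SystemLSDRealSegment.BetaThinnedRootKernel

open Literature.NumberTheory.Sieve
open Summit.Parity.BatemanHorn.Cruxes.LSDRealSegment.ProductAnatomySubcritical (exists_forall_one_le_eval)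

noncomputable section

variable {k : ℕ}

/-! ### The rows `n ≥ n₀`: Fubini over `S`-smooth divisor tuples -/

/-- For a row `n` with all `fᵢ(n) ≥ 1`: the level-`x`, `S`-smooth tuple sum is the sum over the `S`-smooth
`1 ≤ m ≤ x` and `d ∈ prodTuples k m` of the weight times the indicator of the tuple congruence at `n`.
[folklore] -/
theorem sum_filter_tuples_smooth_eq {f : Fin k → ℤ[X]} {n : ℕ}
    (hn : ∀ i, (1 : ℤ) ≤ (f i).eval (n : ℤ)) (y : ℝ) (x S : ℕ) :
    ∑ d ∈ (tuples f n).filter (fun d => ∏ i, d i ≤ x ∧ (∏ i, d i) ∈ Nat.smoothNumbers S),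
        ∏ i, thinWeight y (d i) =
      ∑ m ∈ (Icc 1 x).filter (· ∈ Nat.smoothNumbers S), ∑ d ∈ prodTuples k m,
        if ∀ i, ((d i : ℕ) : ℤ) ∣ (f i).eval (n : ℤ) then ∏ i, thinWeight y (d i) else 0 := by
  rw [← Finset.sum_fiberwise_of_maps_to
    (s := (tuples f n).filter (fun d => ∏ i, d i ≤ x ∧ (∏ i, d i) ∈ Nat.smoothNumbers S))
    (t := (Icc 1 x).filter (· ∈ Nat.smoothNumbers S)) (g := fun d => ∏ i, d i) ?_]
  · refine Finset.sum_congr rfl fun m hm => ?_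
    rw [Finset.mem_filter] at hm
    have hfib : ((tuples f n).filter (fun d => ∏ i, d i ≤ x ∧ (∏ i, d i) ∈ Nat.smoothNumbers S)).filter
          (fun d => ∏ i, d i = m) =
        ((tuples f n).filter (fun d => ∏ i, d i ≤ x)).filter (fun d => ∏ i, d i = m) := by
      rw [Finset.filter_filter, Finset.filter_filter]
      refine Finset.filter_congr fun d _ => ⟨fun h => ⟨h.1.1, h.2⟩, fun h => ⟨⟨h.1, ?_⟩, h.2⟩⟩
      rw [h.2]
      exact hm.2
    rw [hfib, filter_tuples_filter_prod_eq hn hm.1, Finset.sum_filter]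
  · intro d hd
    rw [Finset.mem_filter] at hd
    rw [Finset.mem_filter, Finset.mem_Icc]
    refine ⟨⟨Nat.one_le_iff_ne_zero.mpr (Finset.prod_ne_zero_iff.mpr fun i _ => ?_), hd.2.1⟩, hd.2.2⟩
    have h : d i ∈ divSet ((f i).eval (n : ℤ)).toNat := Fintype.mem_piFinset.mp hd.1 i
    exact (Nat.pos_of_mem_divisors h).ne'

/-- Fubini on the rows `n ∈ [n₀, x]` (all values `≥ 1` there), `S`-smooth tuples only:
`Σ_n Σ_{d, ∏dᵢ ≤ x, ∏dᵢ S-smooth} ∏h_y(dᵢ) = Σ_{1≤m≤x, m S-smooth} Σ_{d ∈ prodTuples k m} ∏h_y(dᵢ) · N'_d`,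
`N'_d = #{n ∈ [n₀, x] : dᵢ ∣ fᵢ(n) ∀ i}`. [folklore] -/
theorem sum_Ico_sum_filter_tuples_smooth_eq {f : Fin k → ℤ[X]} {n₀ : ℕ}
    (hn₀ : ∀ n, n₀ ≤ n → ∀ i, (1 : ℤ) ≤ (f i).eval (n : ℤ)) (y : ℝ) (x S : ℕ) :
    ∑ n ∈ Ico n₀ (x + 1), ∑ d ∈ (tuples f n).filter
        (fun d => ∏ i, d i ≤ x ∧ (∏ i, d i) ∈ Nat.smoothNumbers S), ∏ i, thinWeight y (d i) =
      ∑ m ∈ (Icc 1 x).filter (· ∈ Nat.smoothNumbers S), ∑ d ∈ prodTuples k m,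
        (∏ i, thinWeight y (d i)) *
          (#((Ico n₀ (x + 1)).filter fun n : ℕ => ∀ i, ((d i : ℕ) : ℤ) ∣ (f i).eval (n : ℤ)) : ℝ) := by
  rw [Finset.sum_congr rfl fun n hn =>
      sum_filter_tuples_smooth_eq (hn₀ n (Finset.mem_Ico.mp hn).1) y x S,
    Finset.sum_comm]
  refine Finset.sum_congr rfl fun m _ => ?_
  rw [Finset.sum_comm]
  refine Finset.sum_congr rfl fun d _ => ?_
  rw [← Finset.sum_filter, Finset.sum_const, nsmul_eq_mul, mul_comm]

/-! ### The main rows against the main term, `S`-smooth `m` only -/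

/-- `|Σ_{1≤m≤x, m S-smooth} Σ_{d ∈ prodTuples k m} ∏h_y(dᵢ)·N'_d − (x+1) Σ_{1≤m≤x, m S-smooth} b(m)|
≤ (1 + n₀) Σ_{1≤m≤x, m S-smooth} m·b(m)` for `y ≥ 1` (weights `≥ 0`,
`abs_card_filter_Ico_sub_tupleDens_le` tuple by tuple). [folklore] -/
theorem abs_mainRows_smooth_sub_le (f : Fin k → ℤ[X]) {y : ℝ} (hy : 1 ≤ y) (n₀ x S : ℕ) :
    |(∑ m ∈ (Icc 1 x).filter (· ∈ Nat.smoothNumbers S), ∑ d ∈ prodTuples k m,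
        (∏ i, thinWeight y (d i)) *
          (#((Ico n₀ (x + 1)).filter fun n : ℕ => ∀ i, ((d i : ℕ) : ℤ) ∣ (f i).eval (n : ℤ)) : ℝ)) -
      ((x : ℝ) + 1) * ∑ m ∈ (Icc 1 x).filter (· ∈ Nat.smoothNumbers S), bCoeff f y m| ≤
      (1 + n₀) * ∑ m ∈ (Icc 1 x).filter (· ∈ Nat.smoothNumbers S), (m : ℝ) * bCoeff f y m := by
  rw [Finset.mul_sum, ← Finset.sum_sub_distrib, Finset.mul_sum]
  refine (Finset.abs_sum_le_sum_abs _ _).trans (Finset.sum_le_sum fun m hm => ?_)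
  have hm1 : 1 ≤ m := (Finset.mem_Icc.mp (Finset.mem_filter.mp hm).1).1
  unfold bCoeff
  rw [Finset.mul_sum, ← Finset.sum_sub_distrib, Finset.mul_sum, Finset.mul_sum]
  refine (Finset.abs_sum_le_sum_abs _ _).trans (Finset.sum_le_sum fun d hd => ?_)
  have hW := prod_thinWeight_nonneg hy d
  rw [← mul_assoc, mul_comm ((x : ℝ) + 1), mul_assoc, ← mul_sub, abs_mul, abs_of_nonneg hW]
  calc (∏ i, thinWeight y (d i)) *
        |(#((Ico n₀ (x + 1)).filter fun n : ℕ => ∀ i, ((d i : ℕ) : ℤ) ∣ (f i).eval (n : ℤ)) : ℝ) -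
          ((x : ℝ) + 1) * tupleDens f d|
      ≤ (∏ i, thinWeight y (d i)) * ((1 + n₀) * m * tupleDens f d) :=
        mul_le_mul_of_nonneg_left (abs_card_filter_Ico_sub_tupleDens_le f n₀ x hd hm1) hW
    _ = (1 + n₀) * ((m : ℝ) * ((∏ i, thinWeight y (d i)) * tupleDens f d)) := by ring

/-! ### The registered stub -/

/-- **smoothTypeI_sandwich** (registered stub of the checked skeleton, line `beta-thinned-root-kernel`):
for a Bateman–Horn system `f` and real `y ≥ 1` there is `C` (depending on `f`, `y` only) such that for all
levels `x` and smoothness bounds `S`,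
`|T_x^{(S)}(y) − (x+1) Σ_{1≤m≤x, m S-smooth} b_{f,y}(m)| ≤ C (1 + Σ_{1≤m≤x} m·b_{f,y}(m))`, where
`T_x^{(S)}(y)` is the Type-I sum over the divisor tuples of level `∏dᵢ ≤ x` with `S`-smooth product
(Fubini over divisor tuples, periodicity of the tuple congruence, complete residue systems on the rows
`n ≥ n₀` where all values are positive; the rows `n < n₀` are bounded by a constant and the smooth error
sum by the full one since all weights are `≥ 0`). [folklore] -/
theorem smoothTypeI_sandwich :
    ∀ (k : ℕ) (f : Fin k → ℤ[X]), IsBatemanHornSystem f → ∀ y : ℝ, 1 ≤ y → ∃ C : ℝ, ∀ x S : ℕ,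
      |(∑ n ∈ range (x + 1), ∑ d ∈ (tuples f n).filter
          (fun d => ∏ i, d i ≤ x ∧ (∏ i, d i) ∈ Nat.smoothNumbers S), ∏ i, thinWeight y (d i)) -
        ((x : ℝ) + 1) * ∑ m ∈ (Icc 1 x).filter (· ∈ Nat.smoothNumbers S), bCoeff f y m| ≤
      C * (1 + ∑ m ∈ Icc 1 x, (m : ℝ) * bCoeff f y m) := by
  intro k f hf y hy
  obtain ⟨n₀, hn₀⟩ := exists_forall_one_le_eval hf
  have hW0 : ∀ d : Fin k → ℕ, 0 ≤ ∏ i, thinWeight y (d i) := prod_thinWeight_nonneg hy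
  -- the constant from the rows `n < n₀`
  set C₀ : ℝ := ∑ n ∈ range n₀, ∑ d ∈ tuples f n, ∏ i, thinWeight y (d i) with hC₀
  have hC₀0 : 0 ≤ C₀ := Finset.sum_nonneg fun n _ => Finset.sum_nonneg fun d _ => hW0 d
  refine ⟨C₀ + (1 + n₀), fun x S => ?_⟩
  set H : ℝ := ∑ m ∈ Icc 1 x, (m : ℝ) * bCoeff f y m with hH
  have hH0 : 0 ≤ H :=
    Finset.sum_nonneg fun m _ => mul_nonneg (Nat.cast_nonneg _) (bCoeff_nonneg f hy m)
  -- the smooth error sum is at most the full one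
  have hHS : ∑ m ∈ (Icc 1 x).filter (· ∈ Nat.smoothNumbers S), (m : ℝ) * bCoeff f y m ≤ H :=
    Finset.sum_le_sum_of_subset_of_nonneg (Finset.filter_subset _ _) fun m _ _ =>
      mul_nonneg (Nat.cast_nonneg _) (bCoeff_nonneg f hy m)
  -- split the rows at `n₀`
  have hT : (∑ n ∈ range (x + 1), ∑ d ∈ (tuples f n).filter
        (fun d => ∏ i, d i ≤ x ∧ (∏ i, d i) ∈ Nat.smoothNumbers S), ∏ i, thinWeight y (d i)) =
      (∑ n ∈ (range (x + 1)).filter (fun n => n < n₀), ∑ d ∈ (tuples f n).filter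
        (fun d => ∏ i, d i ≤ x ∧ (∏ i, d i) ∈ Nat.smoothNumbers S), ∏ i, thinWeight y (d i)) +
      ∑ n ∈ Ico n₀ (x + 1), ∑ d ∈ (tuples f n).filter
        (fun d => ∏ i, d i ≤ x ∧ (∏ i, d i) ∈ Nat.smoothNumbers S), ∏ i, thinWeight y (d i) := by
    rw [← Finset.sum_filter_add_sum_filter_not (range (x + 1)) (fun n => n < n₀)]
    congr 1
    refine Finset.sum_congr ?_ fun _ _ => rfl
    ext n
    simp only [Finset.mem_filter, Finset.mem_range, Finset.mem_Ico]
    omega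
  -- the rows `n < n₀`: between `0` and `C₀`
  have hT1 : 0 ≤ ∑ n ∈ (range (x + 1)).filter (fun n => n < n₀), ∑ d ∈ (tuples f n).filter
        (fun d => ∏ i, d i ≤ x ∧ (∏ i, d i) ∈ Nat.smoothNumbers S), ∏ i, thinWeight y (d i) ∧
      ∑ n ∈ (range (x + 1)).filter (fun n => n < n₀), ∑ d ∈ (tuples f n).filter
        (fun d => ∏ i, d i ≤ x ∧ (∏ i, d i) ∈ Nat.smoothNumbers S), ∏ i, thinWeight y (d i) ≤ C₀ := by
    refine ⟨Finset.sum_nonneg fun n _ => Finset.sum_nonneg fun d _ => hW0 d, ?_⟩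
    calc ∑ n ∈ (range (x + 1)).filter (fun n => n < n₀), ∑ d ∈ (tuples f n).filter
          (fun d => ∏ i, d i ≤ x ∧ (∏ i, d i) ∈ Nat.smoothNumbers S), ∏ i, thinWeight y (d i)
        ≤ ∑ n ∈ range n₀, ∑ d ∈ (tuples f n).filter
          (fun d => ∏ i, d i ≤ x ∧ (∏ i, d i) ∈ Nat.smoothNumbers S), ∏ i, thinWeight y (d i) := by
          refine Finset.sum_le_sum_of_subset_of_nonneg (fun n hn => ?_) fun n _ _ =>
            Finset.sum_nonneg fun d _ => hW0 d
          rw [Finset.mem_filter] at hn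
          exact Finset.mem_range.mpr hn.2
      _ ≤ C₀ := Finset.sum_le_sum fun n _ =>
          Finset.sum_le_sum_of_subset_of_nonneg (Finset.filter_subset _ _) fun d _ _ => hW0 d
  -- the rows `n ≥ n₀`: Fubini and complete residue systems
  have hn₀0 : (0 : ℝ) ≤ 1 + n₀ := by positivity
  have hmain := (abs_mainRows_smooth_sub_le f hy n₀ x S).trans (mul_le_mul_of_nonneg_left hHS hn₀0)
  rw [← sum_Ico_sum_filter_tuples_smooth_eq hn₀ y x S] at hmain
  rw [hT, add_sub_assoc]
  refine (abs_add_le _ _).trans ?_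
  rw [abs_of_nonneg hT1.1]
  calc _ ≤ C₀ + (1 + n₀) * H := add_le_add hT1.2 hmain
    _ ≤ (C₀ + (1 + n₀)) * (1 + H) := by nlinarith

end

end Summit.Parity.BatemanHorn.Cruxes.SystemLSDRealSegment.BetaThinnedRootKernel
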